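import Mathlib.Data.Real.Basic
import Mathlib.Tactic

/-!
# Klainerman–Szeftel (refereed) ch. 6 "Ref 2" (6.1.19) ⇒ Remark 6.1.8 (6.1.21): the three interpolation exponents, as real arithmetic

CITATION HEADER (lean-in-tree rule 2026-08-18).  Kernel-checked transcription of SMALL-CONSTANT BOOKKEEPING printed in
* [KS] S. Klainerman, J. Szeftel, *Kerr stability for small angular momentum*, Pure Appl. Math. Q. **19** (2023) no. 3, 791–1678
  = bib key `KlainermanSzeftel2023`, read as the authors' accepted version HAL hal-04280491 (`HAL p.N` = PDF page); arXiv:2104.11857v1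
  (TeX `Main-Kerr-arxiv.tex`, `KS l.N`) = bib key `KlainermanSzeftel2021` for the v1 wording.

WHAT IS TRANSCRIBED.  Refereed [KS] §6.1.3, block "Ref 2" (HAL p.343 L22–38): "According to Theorem M1, we have on (ext)M, for all
0 ≤ k ≤ k_*,  ‖A‖_{∞,k} ≲ ε₀ min{r^{−3}(u+2r)^{−1/2−δ_extra}, r^{−2}u^{−1−δ_extra}},  ‖∇₃A‖_{∞,k−1} ≲ ε₀ min{r^{−9/2−δ_dec},
r^{−4}u^{−1/2−δ_extra}, r^{−3}u^{−1−δ_extra}},  ‖∇²₃A‖_{∞,k−1} ≲ ε₀ min{r^{−9/2−δ_dec}u^{−1/2−δ_extra}, r^{−4}u^{−1−δ_extra}},  (6.1.19)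
where we recall that δ_extra > δ_dec" (v1 KS l.13756–13765 had different branches: `log(1+u) r^{−2}(u+2r)^{−1−δ_extra}` for A and
`r^{−4}(u+2r)^{−1/2−δ_extra}` for ∇₃A — the refereed text weakened Theorem M1 item 2 and rewrote this block, audit cell finding E26(a));
Remark 6.1.8 (HAL p.344 L6–11): "Let δ′ := ½(δ_extra − δ_dec), (6.1.20) where δ′ > 0 since δ_extra > δ_dec.  In view of Definition 6.1.4
and Ref 2, we have  A ∈ r^{−2−δ′}Good_{k_*},  ∇₃A ∈ r^{−3−δ′}Good_{k_*},  ∇²₃A ∈ r^{−4−δ′}Good_{k_*}.  (6.1.21)", with Definition 6.1.4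
(HAL p.342): "U ∈ r^{−p}Good_k if |𝔡^{≤k}U| ≲ ε₀ r^{−p} u^{−1−δ_dec}".  On (ext)M one has r ≥ r₀ ≥ 1, u ≥ 1, u + 2r ≥ u (HAL p.385 fn 15).

WHAT IS CERTIFIED.  For a two-branch bound `X ≤ min{B₁, B₂}` one has `X ≤ B₁^θ B₂^{1−θ}` for every `θ ∈ [0,1]`; with monomial branches
`B_i = r^{−a_i} u^{−b_i}` (and `(u+2r)^{−c} ≤ u^{−c}`, all bases ≥ 1) the membership `X ∈ r^{−p}Good` follows as soon as the interpolated
exponents satisfy `θa₁ + (1−θ)a₂ ≥ p` and `θb₁ + (1−θ)b₂ ≥ 1 + δ_dec`.  This file checks ONLY that exponent arithmetic, for the three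
memberships of (6.1.21), with explicit θ's (the module's choice; the papers print none):
* `refA`   : A,    branches (3, 1/2+δ_extra) [via (u+2r)^{-…} ≤ u^{-…}] and (2, 1+δ_extra), θ = δ′:   r-exponent = 2 + δ′ exactly,
             u-exponent ≥ 1 + δ_dec  ⟸  δ_dec < δ_extra ≤ 1;
* `refDA`  : ∇₃A,  branches (9/2+δ_dec, 0) and (3, 1+δ_extra), θ = 2δ′/3:  r ≥ 3 + δ′ ⟸ δ_dec ≥ 0,  u ≥ 1 + δ_dec ⟸ δ_extra ≤ 2;
* `refDDA` : ∇²₃A, branches (9/2+δ_dec, 1/2+δ_extra) and (4, 1+δ_extra), θ = 2δ′:  r ≥ 4 + δ′ ⟸ δ_dec ≥ 0,  u ≥ 1 + δ_dec ⟸ δ_dec ≤ δ_extra,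
             and θ ≤ 1 ⟸ δ_extra − δ_dec ≤ 1;
so Remark 6.1.8's "In view of … Ref 2" is an elementary interpolation under the printed `0 ≤ δ_dec < δ_extra` and the smallness
`δ_extra ≤ 1` — an explicit hypothesis of the lemmas below; its SOURCE (v2, REFEREE #32 P6): δ_extra is EXISTENTIAL in [KS] Thm M1
(HAL p.157 L54 "there exists δ_extra > δ_dec"; (3.4.1), HAL p.140 L1–6, constrains δ_H, δ_dec, δ_B, δ_* (≪ min{m₀−|a₀|, 1},
δ_B > 2δ_dec), r₀ and k_large only) and its VALUE is fixed in the refereed [GKS] (Pure Appl. Math. Q. 20 (2024) no. 7, bib key `GiorgiKlainermanSzeftel2024`, PAMQ p.533 L2/L37 "choosing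
δ_extra = (3δ_dec − 2δ)/2 > δ_dec" (so read with v1 GKS TeX l.22524 `\frac{3\dec-2\de}{2}`; the text layer prints "3δdec2−2δ"), p.535 L4
"δ_extra = δ_dec + δ/2"), whence `δ_extra ≤ 1` follows from the smallness `δ_dec ≪ 1` of
[KS] (3.4.1).  Pure linear/real arithmetic (0 sorry; axioms standard).  NOTHING about Theorem M1, the frames or the estimates is
asserted; the monomial-comparison step itself (`rpow` monotonicity on bases ≥ 1) is not formalised here — only its exponent hypotheses.
One-derivative slack recorded, not used: (6.1.19) bounds ∇₃A, ∇²₃A at level k − 1 (k ≤ k_*), so (6.1.21)'s `Good_{k_*}` for them reads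
`Good_{k_*−1}` strictly — as the refereed text itself writes at (6.5.4), HAL p.394 L17–20 ("∇₃A ∈ r^{−3−δ′}Good_{k_*−1}").

STATUS / RELATION.  [KS] is refereed; this is the audit cell `pub-kerr`'s kernel companion of its finding E20/E26(a) RE-STAMPED ON THE
REFEREED TEXT: every ch. 6–7 invocation of Theorem M1's A-bounds in the refereed [KS] (HAL p.381 L47/L64, p.382 L26, p.384 L6, p.385 L50–62,
p.386 L47–57, p.388 L4, p.391 L3, p.392 L18, p.394 L17, p.405 L93, p.406 L57 — all through (6.1.19)/(6.1.21); ch. 7 p.432 L8 through M1 item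
2's interior clause) consumes only (6.1.21), and (6.1.21) follows from the refereed (6.1.19) by the arithmetic below (cell file GAPS.md,
block "JUNCTION IN THE REFEREED PAIR", addendum E20-J).  Companion of `InterpolatedRates` (`deltaPrimeKS` = δ′ there) and `JunctionLevels`;
Mathlib only.  Nothing here is Final-State-Conjecture progress.
-/

noncomputable section

namespace Literature.Geometry.Lorentzian.KlainermanSzeftel2021.RefTwoExponents

/-- [KS] (6.1.20): `δ′ := ½(δ_extra − δ_dec)` (= `InterpolatedRates.deltaPrimeKS`). [cite: KlainermanSzeftel2023, (6.1.20), HAL hal-04280491 p.344 L6–8] -/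
def deltaPrime (δextra δdec : ℝ) : ℝ := (δextra - δdec) / 2

/-- The interpolated exponent `θ·e₁ + (1 − θ)·e₂` of `B₁^θ B₂^{1−θ}` for monomial branches. [folklore] -/
def mix (θ e₁ e₂ : ℝ) : ℝ := θ * e₁ + (1 - θ) * e₂

/-- Unfolding lemma. [folklore] -/
@[simp] lemma deltaPrime_def (δextra δdec : ℝ) : deltaPrime δextra δdec = (δextra - δdec) / 2 := rfl
/-- Unfolding lemma. [folklore] -/
@[simp] lemma mix_def (θ e₁ e₂ : ℝ) : mix θ e₁ e₂ = θ * e₁ + (1 - θ) * e₂ := rfl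

/-- `δ′ > 0 ⟺ δ_extra > δ_dec` ("δ′ > 0 since δ_extra > δ_dec", HAL p.344 L8). [cite: KlainermanSzeftel2023, Remark 6.1.8, HAL hal-04280491 p.344] -/
theorem deltaPrime_pos_iff (δextra δdec : ℝ) : 0 < deltaPrime δextra δdec ↔ δdec < δextra := by
  simp only [deltaPrime]; constructor <;> intro h <;> linarith

/-- **A ∈ r^{−2−δ′}Good** from the two branches of (6.1.19) for `A` with `θ = δ′`: r-exponent `3δ′ + 2(1−δ′) = 2 + δ′` EXACTLY, and
u-exponent `(1/2+δ_extra)δ′ + (1+δ_extra)(1−δ′) ≥ 1 + δ_dec` (even after dropping the first branch's u-decay: `(1+δ_extra)(1−δ′) ≥ 1+δ_dec`)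
provided `δ_dec < δ_extra ≤ 1`. [cite: KlainermanSzeftel2023, (6.1.19)/(6.1.21) first membership, HAL hal-04280491 p.343–344] -/
theorem refA {δextra δdec : ℝ} (h1 : δdec < δextra) (h2 : δextra ≤ 1) :
    mix (deltaPrime δextra δdec) 3 2 = 2 + deltaPrime δextra δdec ∧
    1 + δdec ≤ (1 - deltaPrime δextra δdec) * (1 + δextra) ∧
    1 + δdec ≤ mix (deltaPrime δextra δdec) (1 / 2 + δextra) (1 + δextra) := by
  simp only [mix, deltaPrime]
  refine ⟨by ring, ?_, ?_⟩ <;> nlinarith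

/-- **∇₃A ∈ r^{−3−δ′}Good** from the branches `r^{−9/2−δ_dec}` and `r^{−3}u^{−1−δ_extra}` with `θ = 2δ′/3`: r-exponent `≥ 3 + δ′` (needs
`δ_dec ≥ 0`; equality at `δ_dec = 0`) and u-exponent `(1+δ_extra)(1 − 2δ′/3) ≥ 1 + δ_dec` (needs `δ_extra ≤ 2`).
[cite: KlainermanSzeftel2023, (6.1.19)/(6.1.21) second membership, HAL hal-04280491 p.343–344] -/
theorem refDA {δextra δdec : ℝ} (h0 : 0 ≤ δdec) (h1 : δdec < δextra) (h2 : δextra ≤ 2) :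
    3 + deltaPrime δextra δdec ≤ mix (2 * deltaPrime δextra δdec / 3) (9 / 2 + δdec) 3 ∧
    1 + δdec ≤ mix (2 * deltaPrime δextra δdec / 3) 0 (1 + δextra) ∧
    0 ≤ 2 * deltaPrime δextra δdec / 3 ∧ 2 * deltaPrime δextra δdec / 3 ≤ 1 := by
  simp only [mix, deltaPrime]
  refine ⟨?_, ?_, ?_, ?_⟩ <;> nlinarith

/-- **∇²₃A ∈ r^{−4−δ′}Good** from the branches `r^{−9/2−δ_dec}u^{−1/2−δ_extra}` and `r^{−4}u^{−1−δ_extra}` with `θ = 2δ′`: r-exponent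
`4 + 2δ′(1/2+δ_dec) ≥ 4 + δ′` (needs `δ_dec ≥ 0`), u-exponent `= 1 + δ_extra − δ′ = 1 + (δ_extra+δ_dec)/2 ≥ 1 + δ_dec`, and `θ ≤ 1` iff
`δ_extra − δ_dec ≤ 1`. [cite: KlainermanSzeftel2023, (6.1.19)/(6.1.21) third membership, HAL hal-04280491 p.343–344] -/
theorem refDDA {δextra δdec : ℝ} (h0 : 0 ≤ δdec) (h1 : δdec < δextra) (h2 : δextra - δdec ≤ 1) :
    4 + deltaPrime δextra δdec ≤ mix (2 * deltaPrime δextra δdec) (9 / 2 + δdec) 4 ∧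
    mix (2 * deltaPrime δextra δdec) (1 / 2 + δextra) (1 + δextra) = 1 + (δextra + δdec) / 2 ∧
    1 + δdec ≤ 1 + (δextra + δdec) / 2 ∧
    0 ≤ 2 * deltaPrime δextra δdec ∧ 2 * deltaPrime δextra δdec ≤ 1 := by
  simp only [mix, deltaPrime]
  refine ⟨?_, by ring, ?_, ?_, ?_⟩ <;> nlinarith

/-- The margins are NOT uniform in δ′ → 0: e.g. the u-margin of `refA` (second clause) is exactly `δ′(1 − δ_extra)`, which vanishes at
`δ_extra = 1` — recorded to show where the (printed) smallness of the constants enters. [folklore] -/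
theorem refA_u_margin (δextra δdec : ℝ) :
    (1 - deltaPrime δextra δdec) * (1 + δextra) - (1 + δdec) = deltaPrime δextra δdec * (1 - δextra) := by
  simp only [deltaPrime]; ring

end Literature.Geometry.Lorentzian.KlainermanSzeftel2021.RefTwoExponents

end
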